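import Literature.Computability.QuantumComplexity.SandwichApprox
import Literature.Computability.QuantumComplexity.UncomputeBranches
import HarnessLib

/-!
# Conjugating an approximate controlled gate by classical compute/uncompute maps

Topic `Literature/Computability/QuantumComplexity`, a complement to `ApproxImplementation.lean`
(`ImplOn`) and `UncomputeBranches.lean` (`IsBasisMap`: matrices permuting basis states, e.g. compiled
reversible classical programs). A recurring step in machines whose rotations depend on data computed
from other registers (Grover–Rudolph state preparation with angles computed from prefix masses,
Regev 2009, Lemma 3.12: "it suffices to be able to compute … to within good precision"; in general
Bennett's compute–use–uncompute, Bennett 1973 / Nielsen–Chuang 2010, §3.2.5): a classical block `C₁`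
writes auxiliary data `A(z)` (along `κ₁`), a gadget `G` implements the controlled gate
`ctrlGate t U'` whose block `U'` READS the auxiliary register, and a classical block `C₂` (along `κ₂`)
erases the data again. If `A` neither reads nor writes the rotated wire `t`, the composite implements
`ctrlGate t U` with `U z = U' (κ₁ z)` — the block as a function of the ORIGINAL data — with the same
error, on the inputs where the auxiliary register is clean:

* `ctrlGate_mulVec_basisState_eq_sum` — `ctrlGate t U |w⟩ = Σ_b U w [b, w t] • |w[t ↦ b]⟩`;
* **`implOn_conj_ctrlGate`** — from `ImplOn P' G (ctrlGate t U') ε`, basis maps `C₁, C₂` (contractions)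
  along `κ₁, κ₂` with `κ₁(P) ⊆ P'`, `U' ∘ κ₁ = U` on `P`, `(κ₁ z) t = z t` and
  `κ₂ ((κ₁ z)[t ↦ b]) = z[t ↦ b]` on `P`: `ImplOn P (C₂ G C₁) (ctrlGate t U) ε`.

Everything here is proved; no definition, no named fact.

## References

* C. H. Bennett, *Logical reversibility of computation*, IBM J. Res. Develop. 17 (1973), §2.
* M. A. Nielsen, I. L. Chuang, *Quantum Computation and Quantum Information*, CUP 2010, §3.2.5
  (uncomputation), §4.3 (controlled operations) [NielsenChuang2010].
* O. Regev, *On lattices, learning with errors, random linear codes, and cryptography*, J. ACM 56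
  (2009), art. 34, Lemma 3.12 (proof) [Regev2009].
-/

noncomputable section

namespace Literature.Computability.QuantumComplexity

open _root_.Matrix Finset Cryptography

variable {N : ℕ}

/-- **A label-controlled one-qubit gate on a basis state**, as a sum over the new bit:
`ctrlGate t U |w⟩ = Σ_b U w [b, w t] • |w[t ↦ b]⟩`. [cite: NielsenChuang2010, §4.3] -/
theorem ctrlGate_mulVec_basisState_eq_sum (t : Fin N) (U : QReg N → Matrix (QReg 1) (QReg 1) ℂ) (w : QReg N) :
    ctrlGate t U *ᵥ basisState w = ∑ b : Bool, U w (fun _ => b) (fun _ => w t) • basisState (Function.update w t b) := by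
  rw [Fintype.sum_bool]
  ext x
  rw [mulVec_basisState]
  dsimp only
  rw [ctrlGate_apply]
  simp only [Pi.add_apply, Pi.smul_apply, basisState, Pi.single_apply, smul_eq_mul, mul_ite, mul_one, mul_zero]
  have hne : ∀ b : Bool, Function.update w t b ≠ Function.update w t (!b) := fun b e => by
    have := congrFun e t; simp at this
  by_cases h : EqOff [t] w x
  · rw [if_pos h]
    have hx : x = Function.update w t (x t) := by rw [eqOff_singleton_iff.1 h]; simp
    cases hxt : x t
    · rw [hxt] at hx
      rw [if_neg (by rw [hx]; exact hne false), if_pos hx, zero_add]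
    · rw [hxt] at hx
      rw [if_pos hx, if_neg (by rw [hx]; exact hne true), add_zero]
  · rw [if_neg h, if_neg, if_neg, add_zero]
    · intro e; apply h; rw [e]; exact eqOff_singleton_iff.2 (by simp)
    · intro e; apply h; rw [e]; exact eqOff_singleton_iff.2 (by simp)

/-- **Compute – controlled gate – uncompute.** Let `G` implement `ctrlGate t U'` on `P'` up to `ε`, let
`C₁`, `C₂` be contractions permuting the basis states along `κ₁`, `κ₂`, and assume, for the inputs
`z ∈ P`: `κ₁ z ∈ P'`, the block read after the computation is the intended one (`U' (κ₁ z) = U z`),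
the computation does not change the wire `t` (`(κ₁ z) t = z t`) and the uncomputation undoes it
whatever the new content of `t` (`κ₂ ((κ₁ z)[t ↦ b]) = z[t ↦ b]`). Then `C₂ G C₁` implements
`ctrlGate t U` on `P` up to `ε`. [cite: NielsenChuang2010, §3.2.5 and §4.3] [cite: Regev2009, Lemma 3.12 (proof)] -/
theorem implOn_conj_ctrlGate {P P' : Set (QReg N)} {C₁ C₂ G : Matrix (QReg N) (QReg N) ℂ} {κ₁ κ₂ : QReg N → QReg N}
    (hC₁ : IsBasisMap C₁ κ₁) (hC₂ : IsBasisMap C₂ κ₂) (hC₁c : IsContraction C₁) (hC₂c : IsContraction C₂)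
    (t : Fin N) {U U' : QReg N → Matrix (QReg 1) (QReg 1) ℂ} {ε : ℝ} (hε : 0 ≤ ε)
    (hG : ImplOn P' G (ctrlGate t U') ε)
    (hP : ∀ z ∈ P, κ₁ z ∈ P') (hU : ∀ z ∈ P, U' (κ₁ z) = U z) (ht : ∀ z ∈ P, κ₁ z t = z t)
    (hback : ∀ z ∈ P, ∀ b : Bool, κ₂ (Function.update (κ₁ z) t b) = Function.update z t b) :
    ImplOn P (C₂ * G * C₁) (ctrlGate t U) ε := by
  classical
  intro ψ hψ
  -- (1) `C₁ψ` is supported on `P'`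
  have h1 : SuppIn P' (C₁ *ᵥ ψ) := by
    intro x hx
    rw [hC₁.mulVec_eq_sum, Finset.sum_apply]
    refine Finset.sum_eq_zero fun z _ => ?_
    rw [Pi.smul_apply, basisState_apply, smul_eq_mul]
    by_cases hz : z ∈ P
    · have hne : x ≠ κ₁ z := fun e => hx (e ▸ hP z hz)
      rw [if_neg hne, mul_zero]
    · rw [hψ z hz, zero_mul]
  -- (2) the exact identity `C₂ (ctrlGate t U') C₁ ψ = ctrlGate t U ψ`
  have h2 : C₂ *ᵥ (ctrlGate t U' *ᵥ (C₁ *ᵥ ψ)) = ctrlGate t U *ᵥ ψ := by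
    rw [hC₁.mulVec_eq_sum]
    conv_rhs => rw [state_eq_sum_smul_basisState ψ]
    rw [Matrix.mulVec_sum, Matrix.mulVec_sum, Matrix.mulVec_sum]
    refine Finset.sum_congr rfl fun z _ => ?_
    by_cases hz : z ∈ P
    · rw [Matrix.mulVec_smul, Matrix.mulVec_smul, Matrix.mulVec_smul, ctrlGate_mulVec_basisState_eq_sum,
        ctrlGate_mulVec_basisState_eq_sum, Matrix.mulVec_sum, hU z hz, ht z hz]
      congr 1
      refine Finset.sum_congr rfl fun b _ => ?_
      rw [Matrix.mulVec_smul, hC₂, hback z hz b]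
    · simp [hψ z hz]
  -- (3) the error is that of `G` on `C₁ψ`, transported by the contraction `C₂`
  calc l2Norm ((C₂ * G * C₁) *ᵥ ψ - ctrlGate t U *ᵥ ψ)
      = l2Norm (C₂ *ᵥ (G *ᵥ (C₁ *ᵥ ψ) - ctrlGate t U' *ᵥ (C₁ *ᵥ ψ))) := by
        rw [Matrix.mulVec_sub, h2, ← Matrix.mulVec_mulVec, ← Matrix.mulVec_mulVec]
    _ ≤ l2Norm (G *ᵥ (C₁ *ᵥ ψ) - ctrlGate t U' *ᵥ (C₁ *ᵥ ψ)) := hC₂c _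
    _ ≤ ε * l2Norm (C₁ *ᵥ ψ) := hG _ h1
    _ ≤ ε * l2Norm ψ := mul_le_mul_of_nonneg_left (hC₁c ψ) hε

end Literature.Computability.QuantumComplexity

end
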